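import Summits.KontsevichZagierPeriods.KontsevichZagierPeriods.Theorems.SoloBlindMixedDuplication
import HarnessLib

/-!
# Triplication `B(a,1-3a) = 3^{-3a}[B(2a,⅓-a) + B(2a,⅔-a)]`, I: the real identities

Gauss's triplication `Γ(a)Γ(a+⅓)Γ(a+⅔) = 2π·3^{½-3a} Γ(3a)` has two-term shadows among Beta
values of the FIRST kind, and — unlike what rational (Belyi) pull-backs suggest — they are realised
inside the Kontsevich–Zagier rules by a ONE-dimensional chain. The substitution is the nested
radical

  `Ψ(u) = (1 - q)²/(1 + q + q²)`,  `q = (1-u)^{1/3}`  (so `Ψ(u) = (1 - (1-u)^{1/3})³/u`),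

an increasing semialgebraic `C¹` bijection of `(0,1)` with `1 - Ψ = 3q/(1+q+q²)`,
`u = (1-q)(1+q+q²)` and `Ψ' = (1-q)(1+q)/(q²(1+q+q²)²)`. The key identity, for all real `a, b`:

  `Ψ^{a-1} (1-Ψ)^{b-1} Ψ' = 3^{b-1} (1-q)^{3a+b-1} (1+q) q^{b-3} u^{-a-b}`,

collapses for `3a + b = 1` to `3^{b-1} u^{2a-1}[(1-u)^{b/3-1} + (1-u)^{(b+1)/3-1}]` and for
`3a + b = 2` to `3^{b-1} u^{2a-2}[(1-u)^{b/3-1} - (1-u)^{(b+2)/3-1}]` — sums of two Beta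
integrands. (Geometrically, `Ψ` is the real branch `λ₁ = 1/u > 1` of the base correspondence
`27λ₁(1-λ₁)(-λ₂) = (1-λ₂)³` under the cubic curve `w³ = (-3)^{1/d}xyz` on the Fermat surface of
Aoki–Shioda.)

This file: the functions, `Ψ` as a bijection (derivative, injectivity, image by the intermediate
value theorem), the pull-back identities, integrability and semialgebraicity. The moves are
performed in `SoloBlindTriplication`.

References: N. Aoki, T. Shioda, *Generators of the Néron–Severi group of a Fermat surface*,
Prog. Math. 35 (1983), Thm. 2; M. Kontsevich, D. Zagier, *Periods* (2001), §1.2.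
-/

noncomputable section

open Set MeasureTheory MvPolynomial

namespace Summit.KontsevichZagierPeriods.KontsevichZagierPeriods.Theorems

namespace SoloBlind

open Literature.ModelTheory.ExponentialFields (IsSemialgebraic)
open Literature.NumberTheory.Transcendental
open Literature.NumberTheory.Transcendental.KZ
open Literature.Analysis.SpecialFunctions.Selberg

/-! ## The functions -/

/-- The Beta integrand `t^{a-1}(1-t)^{b-1}` (syntactically that of `betaRep a b`). -/
def betaFun (a b : ℚ) (t : ℝ) : ℝ := t ^ ((a : ℝ) - 1) * (1 - t) ^ ((b : ℝ) - 1)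

/-- `q(u) = (1-u)^{1/3}`. -/
def triQ (u : ℝ) : ℝ := (1 - u) ^ ((1:ℝ) / 3)

/-- The substitution `Ψ(u) = (1-q)²/(1+q+q²)`, `q = (1-u)^{1/3}`. -/
def triPsi (u : ℝ) : ℝ := (1 - triQ u) * (1 - triQ u) / (1 + triQ u + triQ u * triQ u)

/-- `Ψ'(u) = (1-q)(1+q)q/((1+q+q²)²(1-u))` (`= (1-q)(1+q)/(q²(1+q+q²)²)` as `1 - u = q³`). -/
def triPsi' (u : ℝ) : ℝ :=
  (1 - triQ u) * (1 + triQ u) * triQ u / ((1 + triQ u + triQ u * triQ u) ^ 2 * (1 - u))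

/-- Source integrand for `3a + b = 1`: `3^{b-1}[β-integrand(2a, b/3) + β-integrand(2a, (b+1)/3)]`. -/
def triF0 (a b : ℚ) (u : ℝ) : ℝ :=
  (3:ℝ) ^ ((b : ℝ) - 1) * (betaFun (2 * a) (b / 3) u + betaFun (2 * a) ((b + 1) / 3) u)

/-- Source integrand for `3a + b = 2`:
`3^{b-1}[β-integrand(2a-1, b/3) - β-integrand(2a-1, (b+2)/3)]`. -/
def triF1 (a b : ℚ) (u : ℝ) : ℝ :=
  (3:ℝ) ^ ((b : ℝ) - 1) * (betaFun (2 * a - 1) (b / 3) u - betaFun (2 * a - 1) ((b + 2) / 3) u)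

/-! ## The radical `q` -/

/-- `0 ≤ q` for `u ≤ 1`. -/
theorem triQ_nonneg {u : ℝ} (h1 : u ≤ 1) : 0 ≤ triQ u := Real.rpow_nonneg (by linarith) _

/-- `0 < q` for `u < 1`. -/
theorem triQ_pos {u : ℝ} (h1 : u < 1) : 0 < triQ u := Real.rpow_pos_of_pos (by linarith) _

/-- `q < 1` for `0 < u ≤ 1`. -/
theorem triQ_lt_one {u : ℝ} (h0 : 0 < u) (h1 : u ≤ 1) : triQ u < 1 :=
  Real.rpow_lt_one (by linarith) (by linarith) (by norm_num)

/-- `q³ = 1 - u`. -/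
theorem triQ_cube {u : ℝ} (h1 : u ≤ 1) : triQ u ^ 3 = 1 - u := by
  unfold triQ
  rw [← Real.rpow_natCast, ← Real.rpow_mul (by linarith)]
  norm_num

/-- `u = (1-q)(1+q+q²)`. -/
theorem tri_u_eq {u : ℝ} (h1 : u ≤ 1) : u = (1 - triQ u) * (1 + triQ u + triQ u * triQ u) := by
  linear_combination triQ_cube h1

/-- `q^x = (1-u)^{x/3}`. -/
theorem triQ_rpow {u : ℝ} (h1 : u ≤ 1) (x : ℝ) : triQ u ^ x = (1 - u) ^ (x / 3) := by
  unfold triQ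
  rw [← Real.rpow_mul (by linarith)]
  congr 1
  ring

/-- `1 + q + q² > 0` (for every real `u`). -/
theorem tri_s_pos (u : ℝ) : 0 < 1 + triQ u + triQ u * triQ u := by
  nlinarith [sq_nonneg (triQ u + 1 / 2)]

/-- `q(0) = 1`. -/
theorem triQ_zero : triQ 0 = 1 := by simp [triQ]

/-- `q(1) = 0`. -/
theorem triQ_one : triQ 1 = 0 := by
  simp only [triQ, sub_self]
  exact Real.zero_rpow (by norm_num)

/-- `q` is continuous. -/
theorem continuous_triQ : Continuous triQ := by
  show Continuous ((fun x : ℝ => x ^ ((1:ℝ) / 3)) ∘ fun u : ℝ => 1 - u)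
  exact (Real.continuous_rpow_const (by norm_num)).comp (continuous_const.sub continuous_id)

/-- `q' = -(1/3)(1-u)^{1/3 - 1}` inside `u < 1`. -/
theorem hasDerivAt_triQ {u : ℝ} (h1 : u < 1) :
    HasDerivAt triQ (-1 * ((1:ℝ) / 3) * (1 - u) ^ ((1:ℝ) / 3 - 1)) u := by
  unfold triQ
  exact ((hasDerivAt_id u).const_sub 1).rpow_const (Or.inl (by simp only [id]; linarith))

/-! ## The substitution `Ψ` -/

/-- `Ψ = (1-q)²/(1+q+q²)`. -/
theorem triPsi_eq (u : ℝ) : triPsi u = (1 - triQ u) ^ 2 / (1 + triQ u + triQ u * triQ u) := by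
  simp only [triPsi]
  ring

/-- `1 - Ψ = 3q/(1+q+q²)`. -/
theorem one_sub_triPsi (u : ℝ) : 1 - triPsi u = 3 * triQ u / (1 + triQ u + triQ u * triQ u) := by
  rw [triPsi, eq_div_iff (tri_s_pos u).ne', sub_mul, div_mul_cancel₀ _ (tri_s_pos u).ne']
  ring

/-- `Ψ' = (1-q)(1+q)/(q²(1+q+q²)²)` on `u < 1`. -/
theorem triPsi'_eq {u : ℝ} (h1 : u < 1) :
    triPsi' u = (1 - triQ u) * (1 + triQ u) / (triQ u ^ 2 * (1 + triQ u + triQ u * triQ u) ^ 2) := by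
  have hq := (triQ_pos h1).ne'
  have hs := (tri_s_pos u).ne'
  simp only [triPsi']
  rw [← triQ_cube h1.le]
  field_simp

/-- `0 < Ψ' ` on `(0,1)`. -/
theorem triPsi'_pos {u : ℝ} (h0 : 0 < u) (h1 : u < 1) : 0 < triPsi' u := by
  rw [triPsi'_eq h1]
  have := triQ_pos h1
  have := triQ_lt_one h0 h1.le
  have := tri_s_pos u
  have : 0 < 1 - triQ u := by linarith
  positivity

/-- `0 < Ψ < 1` on `(0,1)`. -/
theorem triPsi_mem {u : ℝ} (h0 : 0 < u) (h1 : u < 1) : triPsi u ∈ Ioo (0:ℝ) 1 := by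
  have hq0 := triQ_pos h1
  have hq1 := triQ_lt_one h0 h1.le
  have hs := tri_s_pos u
  have h1q : 0 < 1 - triQ u := by linarith
  refine ⟨by unfold triPsi; positivity, ?_⟩
  rw [triPsi, div_lt_one hs]
  nlinarith

/-- `Ψ` is differentiable inside `(0,1)` with derivative `triPsi'`. -/
theorem hasDerivAt_triPsi {u : ℝ} (h1 : u < 1) : HasDerivAt triPsi (triPsi' u) u := by
  have hq := hasDerivAt_triQ h1
  have hs := (tri_s_pos u).ne'
  have hu : (1:ℝ) - u ≠ 0 := by linarith
  have h := ((hq.const_sub 1).fun_mul (hq.const_sub 1)).fun_div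
    ((hq.const_add 1).fun_add (hq.fun_mul hq)) hs
  unfold triPsi
  refine h.congr_deriv ?_
  rw [triPsi', Real.rpow_sub_one hu, show (1 - u) ^ ((1:ℝ) / 3) = triQ u from rfl]
  field_simp
  ring

/-- `Ψ` is injective on `(0,1)`: `(1-q₁)²s₂ - (1-q₂)²s₁ = 3(q₂-q₁)(1-q₁q₂)`. -/
theorem injOn_triPsi : InjOn triPsi (Ioo 0 1) := by
  intro x hx y hy h
  have hx0 := triQ_pos hx.2
  have hx1 := triQ_lt_one hx.1 hx.2.le
  have hy0 := triQ_pos hy.2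
  have hy1 := triQ_lt_one hy.1 hy.2.le
  have hsx := (tri_s_pos x).ne'
  have hsy := (tri_s_pos y).ne'
  unfold triPsi at h
  rw [div_eq_div_iff hsx hsy] at h
  have h3 : 3 * (triQ y - triQ x) * (1 - triQ x * triQ y) = 0 := by linear_combination h
  have hne : 1 - triQ x * triQ y ≠ 0 := by nlinarith [mul_lt_mul'' hx1 hy1 hx0.le hy0.le]
  rcases mul_eq_zero.mp h3 with h4 | h4
  · have hq : triQ x = triQ y := by linarith
    have := triQ_cube hx.2.le
    have := triQ_cube hy.2.le
    nlinarith [hq]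
  · exact (hne h4).elim

/-- `Ψ` is continuous. -/
theorem continuous_triPsi : Continuous triPsi := by
  have hq := continuous_triQ
  unfold triPsi
  exact ((continuous_const.sub hq).mul (continuous_const.sub hq)).div
    ((continuous_const.add hq).add (hq.mul hq)) fun u => (tri_s_pos u).ne'

/-- `Ψ(0) = 0`. -/
theorem triPsi_zero : triPsi 0 = 0 := by simp [triPsi, triQ_zero]

/-- `Ψ(1) = 1`. -/
theorem triPsi_one : triPsi 1 = 1 := by simp [triPsi, triQ_one]

/-- `Ψ` maps `(0,1)` onto `(0,1)` (intermediate value theorem; no explicit inverse needed). -/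
theorem image_triPsi : Ioo (0:ℝ) 1 = triPsi '' Ioo 0 1 := by
  refine Subset.antisymm ?_ ?_
  · have h := intermediate_value_Ioo zero_le_one continuous_triPsi.continuousOn
    rwa [triPsi_zero, triPsi_one] at h
  · rintro w ⟨u, ⟨h0, h1⟩, rfl⟩
    exact triPsi_mem h0 h1

/-! ## The pull-back identities -/

/-- **Core identity** (all `a, b`): on `(0,1)`,
`Ψ^{a-1}(1-Ψ)^{b-1}|Ψ'| = 3^{b-1}(1+q)·[(1-q)^{2a-1} s^{-a-b}]·q^{b-3}`, `s = 1+q+q²`. -/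
theorem tri_core (a b : ℚ) {u : ℝ} (h0 : 0 < u) (h1 : u < 1) :
    betaFun a b (triPsi u) * |triPsi' u| =
      (3:ℝ) ^ ((b : ℝ) - 1) * (1 + triQ u) *
        ((1 - triQ u) ^ (2 * (a : ℝ) - 1) * (1 + triQ u + triQ u * triQ u) ^ (-((a : ℝ) + b))) *
        triQ u ^ ((b : ℝ) - 3) := by
  set q := triQ u with hq
  set s := 1 + triQ u + triQ u * triQ u with hs
  have hq0 : 0 < q := triQ_pos h1
  have hq1 : q < 1 := triQ_lt_one h0 h1.le
  have hs0 : 0 < s := tri_s_pos u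
  have h1q : 0 < 1 - q := by linarith
  have hΨ : triPsi u = (1 - q) ^ 2 / s := triPsi_eq u
  have h1Ψ : 1 - triPsi u = 3 * q / s := one_sub_triPsi u
  have hΨ' : |triPsi' u| = (1 - q) * (1 + q) / (q ^ 2 * s ^ 2) := by
    rw [abs_of_pos (triPsi'_pos h0 h1), triPsi'_eq h1]
  unfold betaFun
  rw [h1Ψ, hΨ, hΨ', Real.div_rpow (sq_nonneg _) hs0.le, Real.div_rpow (by positivity) hs0.le,
    Real.mul_rpow (by norm_num) hq0.le, ← Real.rpow_natCast (1 - q) 2,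
    ← Real.rpow_mul h1q.le,
    show (2 * (a : ℝ) - 1) = ((2:ℕ) : ℝ) * ((a : ℝ) - 1) + 1 by push_cast; ring,
    Real.rpow_add_one h1q.ne',
    show -((a : ℝ) + b) = -(((a : ℝ) - 1) + ((b : ℝ) - 1) + 2) by ring, Real.rpow_neg hs0.le,
    Real.rpow_add hs0, Real.rpow_add hs0, Real.rpow_two,
    show q ^ ((b : ℝ) - 3) = q ^ ((b : ℝ) - 1) / q ^ 2 by
      rw [← Real.rpow_two, ← Real.rpow_sub hq0]; congr 1; ring]
  field_simp

/-- `3a + b = 1`: `(1-q)^{2a-1} s^{-a-b} = u^{2a-1}`. -/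
theorem tri_e0 (a b : ℚ) (h : 3 * a + b = 1) {u : ℝ} (h0 : 0 < u) (h1 : u < 1) :
    (1 - triQ u) ^ (2 * (a : ℝ) - 1) * (1 + triQ u + triQ u * triQ u) ^ (-((a : ℝ) + b)) =
      u ^ (2 * (a : ℝ) - 1) := by
  have h' : -((a : ℝ) + b) = 2 * (a : ℝ) - 1 := by
    have := congrArg (Rat.cast : ℚ → ℝ) h
    push_cast at this
    linarith
  have h1q : 0 ≤ 1 - triQ u := by linarith [triQ_lt_one h0 h1.le]
  rw [h', ← Real.mul_rpow h1q (tri_s_pos u).le, ← tri_u_eq h1.le]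

/-- `3a + b = 2`: `(1-q)^{2a-1} s^{-a-b} = u^{2a-2}(1-q)`. -/
theorem tri_e1 (a b : ℚ) (h : 3 * a + b = 2) {u : ℝ} (h0 : 0 < u) (h1 : u < 1) :
    (1 - triQ u) ^ (2 * (a : ℝ) - 1) * (1 + triQ u + triQ u * triQ u) ^ (-((a : ℝ) + b)) =
      u ^ (2 * (a : ℝ) - 1 - 1) * (1 - triQ u) := by
  have h' : -((a : ℝ) + b) = 2 * (a : ℝ) - 1 - 1 := by
    have := congrArg (Rat.cast : ℚ → ℝ) h
    push_cast at this
    linarith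
  have h1q : 0 < 1 - triQ u := by linarith [triQ_lt_one h0 h1.le]
  have hp : (1 - triQ u) ^ (2 * (a : ℝ) - 1) = (1 - triQ u) ^ (2 * (a : ℝ) - 1 - 1) * (1 - triQ u) := by
    rw [← Real.rpow_add_one h1q.ne']; congr 1; ring
  rw [h', hp, mul_right_comm, ← Real.mul_rpow h1q.le (tri_s_pos u).le, ← tri_u_eq h1.le]

/-- **Pull-back for `3a + b = 1`**: `3^{b-1}[u^{2a-1}(1-u)^{b/3-1} + u^{2a-1}(1-u)^{(b+1)/3-1}]
 = Ψ^{a-1}(1-Ψ)^{b-1}|Ψ'|` on `(0,1)`. -/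
theorem tri_pullback0 (a b : ℚ) (h : 3 * a + b = 1) {u : ℝ} (hu : u ∈ Ioo (0:ℝ) 1) :
    triF0 a b u = betaFun a b (triPsi u) * |triPsi' u| := by
  obtain ⟨h0, h1⟩ := hu
  have hq0 := triQ_pos h1
  have e1 : (1 - u) ^ ((b : ℝ) / 3 - 1) = triQ u ^ ((b : ℝ) - 3) := by
    rw [triQ_rpow h1.le]; congr 1; ring
  have e2 : (1 - u) ^ (((b : ℝ) + 1) / 3 - 1) = triQ u ^ ((b : ℝ) - 3) * triQ u := by
    rw [← Real.rpow_add_one hq0.ne', triQ_rpow h1.le]; congr 1; ring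
  rw [tri_core a b h0 h1, tri_e0 a b h h0 h1]
  unfold triF0 betaFun
  push_cast
  rw [e1, e2]
  ring

/-- **Pull-back for `3a + b = 2`**: `3^{b-1}[u^{2a-2}(1-u)^{b/3-1} - u^{2a-2}(1-u)^{(b+2)/3-1}]
 = Ψ^{a-1}(1-Ψ)^{b-1}|Ψ'|` on `(0,1)`. -/
theorem tri_pullback1 (a b : ℚ) (h : 3 * a + b = 2) {u : ℝ} (hu : u ∈ Ioo (0:ℝ) 1) :
    triF1 a b u = betaFun a b (triPsi u) * |triPsi' u| := by
  obtain ⟨h0, h1⟩ := hu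
  have hq0 := triQ_pos h1
  have e1 : (1 - u) ^ ((b : ℝ) / 3 - 1) = triQ u ^ ((b : ℝ) - 3) := by
    rw [triQ_rpow h1.le]; congr 1; ring
  have e3 : (1 - u) ^ (((b : ℝ) + 2) / 3 - 1) = triQ u ^ ((b : ℝ) - 3) * triQ u ^ 2 := by
    rw [← Real.rpow_two, ← Real.rpow_add hq0, triQ_rpow h1.le]; congr 1; ring
  rw [tri_core a b h0 h1, tri_e1 a b h h0 h1]
  unfold triF1 betaFun
  push_cast
  rw [e1, e3]
  ring

/-! ## Integrability and semialgebraicity -/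

/-- The Beta integrand is integrable on `(0,1)` for positive parameters. -/
theorem integrableOn_betaFun (a b : ℚ) (ha : 0 < a) (hb : 0 < b) :
    IntegrableOn (betaFun a b) (Ioo 0 1) :=
  (integrableOn_Ioo_rpow_mul_one_sub_rpow_and_integral_eq (Rat.cast_pos.mpr ha)
    (Rat.cast_pos.mpr hb)).1

/-- The Beta integrand is `ℚ`-semialgebraic on the line `(0,1)` (it is `betaRep`'s). -/
theorem isSemialgebraicFunOn_betaFun (a b : ℚ) (ha : 0 < a) (hb : 0 < b) :
    IsSemialgebraicFunOn ℚ (line (Ioo (0:ℝ) 1)) (fun x : Fin 1 → ℝ => betaFun a b (x 0)) :=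
  (betaRep a b ha hb).isSemialgebraicFunOn_integrand

/-- `3^{x}` is real algebraic for rational `x` (a root of `X^{den} - 3^{num}`). -/
theorem tri_isAlgebraic_three_rpow (x : ℚ) : IsAlgebraic ℚ ((3:ℝ) ^ (x : ℝ)) := by
  refine IsAlgebraic.of_pow x.den_pos ?_
  rw [← Real.rpow_natCast, ← Real.rpow_mul (by norm_num : (0:ℝ) ≤ 3),
    show (x : ℝ) * (x.den : ℕ) = ((x.num : ℤ) : ℝ) by exact_mod_cast x.mul_den_eq_num,
    Real.rpow_intCast]
  simpa using isAlgebraic_rat ℚ (A := ℝ) ((3:ℚ) ^ x.num)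

/-- `3^{b-1}` is real algebraic. -/
theorem tri_coeff_isAlgebraic (b : ℚ) : IsAlgebraic ℚ ((3:ℝ) ^ ((b : ℝ) - 1)) := by
  have h := tri_isAlgebraic_three_rpow (b - 1)
  push_cast at h
  exact h

/-- `triF0` is integrable on `(0,1)` (`a, b > 0`). -/
theorem integrableOn_triF0 (a b : ℚ) (ha : 0 < a) (hb : 0 < b) :
    IntegrableOn (triF0 a b) (Ioo 0 1) :=
  ((integrableOn_betaFun (2 * a) (b / 3) (by positivity) (by positivity)).add
    (integrableOn_betaFun (2 * a) ((b + 1) / 3) (by positivity) (by positivity))).const_mul _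

/-- `triF1` is integrable on `(0,1)` (`a > ½`, `b > 0`). -/
theorem integrableOn_triF1 (a b : ℚ) (ha : 1 / 2 < a) (hb : 0 < b) :
    IntegrableOn (triF1 a b) (Ioo 0 1) :=
  ((integrableOn_betaFun (2 * a - 1) (b / 3) (by linarith) (by positivity)).sub
    (integrableOn_betaFun (2 * a - 1) ((b + 2) / 3) (by linarith) (by positivity))).const_mul _

/-- `triF0` is `ℚ`-semialgebraic on the line `(0,1)`. -/
theorem isSemialgebraicFunOn_triF0 (a b : ℚ) (ha : 0 < a) (hb : 0 < b) :
    IsSemialgebraicFunOn ℚ (line (Ioo (0:ℝ) 1)) (fun x : Fin 1 → ℝ => triF0 a b (x 0)) :=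
  IsSemialgebraicFunOn.mul_holds
    (isSemialgebraicFunOn_const_of_isAlgebraic mix_line_sa (tri_coeff_isAlgebraic b))
    (IsSemialgebraicFunOn.add_holds
      (isSemialgebraicFunOn_betaFun (2 * a) (b / 3) (by positivity) (by positivity))
      (isSemialgebraicFunOn_betaFun (2 * a) ((b + 1) / 3) (by positivity) (by positivity)))

/-- `triF1` is `ℚ`-semialgebraic on the line `(0,1)`. -/
theorem isSemialgebraicFunOn_triF1 (a b : ℚ) (ha : 1 / 2 < a) (hb : 0 < b) :
    IsSemialgebraicFunOn ℚ (line (Ioo (0:ℝ) 1)) (fun x : Fin 1 → ℝ => triF1 a b (x 0)) :=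
  IsSemialgebraicFunOn.mul_holds
    (isSemialgebraicFunOn_const_of_isAlgebraic mix_line_sa (tri_coeff_isAlgebraic b))
    (IsSemialgebraicFunOn.sub_holds
      (isSemialgebraicFunOn_betaFun (2 * a - 1) (b / 3) (by linarith) (by positivity))
      (isSemialgebraicFunOn_betaFun (2 * a - 1) ((b + 2) / 3) (by linarith) (by positivity)))

/-- `x ↦ q(x₀) = (1 - x₀)^{1/3}` is `ℚ`-semialgebraic on the line `(0,1)`. -/
theorem isSemialgebraicFunOn_triQ :
    IsSemialgebraicFunOn ℚ (line (Ioo (0:ℝ) 1)) (fun x : Fin 1 → ℝ => triQ (x 0)) := by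
  have h1 : IsSemialgebraicFunOn ℚ (line (Ioo (0:ℝ) 1)) (fun x : Fin 1 → ℝ => 1 - x 0) :=
    (isSemialgebraicFunOn_aeval mix_line_sa (1 - X 0 : MvPolynomial (Fin 1) ℚ)).congr
      fun x _ => by simp
  refine (IsSemialgebraicFunOn.rpow_ratCast mix_line_sa h1 (fun x hx => ?_) (1 / 3)).congr
    fun x _ => ?_
  · have hx : x 0 ∈ Ioo (0:ℝ) 1 := hx
    linarith [hx.2]
  · simp only [triQ]
    norm_num

/-- `x ↦ Ψ(x₀)` is `ℚ`-semialgebraic on the line `(0,1)`. -/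
theorem isSemialgebraicFunOn_triPsi :
    IsSemialgebraicFunOn ℚ (line (Ioo (0:ℝ) 1)) (fun x : Fin 1 → ℝ => triPsi (x 0)) := by
  have hq := isSemialgebraicFunOn_triQ
  have h1 : IsSemialgebraicFunOn ℚ (line (Ioo (0:ℝ) 1)) (fun _ : Fin 1 → ℝ => (1:ℝ)) :=
    isSemialgebraicFunOn_const_of_isAlgebraic mix_line_sa isAlgebraic_one
  refine (IsSemialgebraicFunOn.div
    (IsSemialgebraicFunOn.mul_holds (IsSemialgebraicFunOn.sub_holds h1 hq)
      (IsSemialgebraicFunOn.sub_holds h1 hq))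
    (IsSemialgebraicFunOn.add_holds (IsSemialgebraicFunOn.add_holds h1 hq)
      (IsSemialgebraicFunOn.mul_holds hq hq)) fun x _ => ?_).congr fun x _ => ?_
  · exact (tri_s_pos (x 0)).ne'
  · simp only [triPsi, Pi.mul_apply, Pi.sub_apply, Pi.add_apply]

end SoloBlind

end Summit.KontsevichZagierPeriods.KontsevichZagierPeriods.Theorems
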